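import Literature.AlgebraicGeometry.AbelianSchemes.TorsionSectionGramUnits
import Literature.AlgebraicGeometry.AbelianSchemes.PolarizedAbelianSchemeWithLevel
import HarnessLib

/-!
# (ii-F) «FIBRE READING OF THE RELATIVE WEIL PAIRING»: for a polarised abelian scheme with level structure, the fibre Weil pairings
# `ē^Θ_M` of base-changed torsion sections are the inverse point values of ONE regular function on the base
# ([MumfordAV1970] §20 p. 184 «`ē^L(x, y) = e_n(x, φ_L(y))`», §23; [Milne1986AbelianVarieties] §16 p. 132)

Layer `Literature/AlgebraicGeometry/AbelianSchemes`, namespace `Literature.AlgebraicGeometry.AbelianSchemes.PolarizedAbelianSchemeWithLevel`.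
THEOREMS ONLY (no definition, no named fact, no instance, no notation, no `sorry`).  Cell `hodgecm-mathlib` (D-0151), FLOOR 0, P6 «MOD»
(crux hLiu418 = stmt-HodgeConjecture-24832, `--supports`), half A line L7 (socket `stub_UNIVFAM` = ★ P-3 `siegelUniversalFamilyUniformisation` →
in-house), sub-organ **FLAT-b(ii-F)** of the heart `stub_FLAT` (LA7-plan (g0) cut 02:40:04Z: (ii-F) fibre comparison → LA7-p01 (g0); (ii-T) constancy
along the chart + the (W=) head → LA7-p02 (g0)).  A PACKAGING of the tree's (h9-S) W1b∕W3a∕W3-core bricks (★ `TorsionPairing.exists_poincarePairingUnit_fun`,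
★ `AbelianSchemeOver.weilPairingLevel_baseChangeTorsionPt_eq_inv`) for the carrier ★ `PolarizedAbelianSchemeWithLevel` (whose fields `pol.isMonHom`,
`hatNormalised` discharge their hypotheses).  HC_CM is proved only modulo the printed citations (2 remaining named inputs hLiu418 24832, h413 24833)
until rung 0 closes; this file is generic and changes no count.

THE MATHEMATICS.  `P = (A, Â, 𝒫, λ, level)` over a reduced locally Noetherian `S`, `f : T′ → S` a locally Noetherian base change (in L7: a finite
étale `T′` over the smooth complex base carrying the torsion sections to be paired), `M ≥ 1`.  For every `M`-torsion section `b` of `A_{T′}` the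
translations by the `M`-torsion sections act on the line bundle `L_{c_b} = (1 × λ b)^*𝒫` over `[M]`, with PAIRING UNITS `u_b(a) ∈ Γ(T′, 𝒪_{T′})`,
`u_b(a)^M = 1` ([MumfordAV1970] §20: the `e_M`-pairing is a section of `μ_M` over the base; ★ W1b).  AT EVERY GEOMETRIC POINT `t` of `T′` and for
EVERY ample witness `Θ` of `λ` on the fibre `A_{t ≫ f}` (★ `IsLambdaOfAt`): `ē^Θ_M(a(t), b(t)) = (u_b(a)(t))⁻¹` (★ W3-core §1) — so the fibre
Weil pairings of `a, b` are the point values of ONE regular function, INDEPENDENT of the witness `Θ`.  Consumer (ii-T): evaluated along a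
continuous lift of the chart's torsion sections into `T′(ℂ)`, a `μ_M`-valued regular function is locally constant — the (W=) flatness reading.

* **`exists_pairingUnit_weilPairingLevel_eq_inv`** — THE HEAD.

## References
* [MumfordAV1970] D. Mumford, *Abelian Varieties* (1970), §20 (pp. 183–185), §23 (p. 228).
* [Milne1986AbelianVarieties] J. S. Milne, *Abelian Varieties* (1986), §16 (p. 132).
-/

set_option autoImplicit false

noncomputable section

-- `Over`-morphism components and the transported group structures are compared across `def`s (as in the tree's W1∕W3 files).
set_option backward.isDefEq.respectTransparency false

universe u

open CategoryTheory CategoryTheory.Limits AlgebraicGeometry MonoidalCategory CartesianMonoidalCategory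
open scoped MonObj

namespace Literature.AlgebraicGeometry.AbelianSchemes.PolarizedAbelianSchemeWithLevel

open Literature.AlgebraicGeometry.RelativeSpec Literature.AlgebraicGeometry.Motives Literature.AlgebraicGeometry.AbelianVarieties
open Literature.AlgebraicGeometry.Modules Literature.AlgebraicGeometry.RelativeSpec.ActionOver

variable {g N : ℕ} {δ : Fin g → ℕ}

/-- **(ii-F) THE FIBRE WEIL PAIRINGS OF TORSION SECTIONS ARE THE INVERSE POINT VALUES OF ONE REGULAR FUNCTION ON THE BASE.**  For a polarised
abelian scheme with level structure `P` over a reduced locally Noetherian `S`, a locally Noetherian base change `f : T′ → S` and `M ≥ 1`, there are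
PAIRING UNITS `u b a ∈ Γ(T′, 𝒪_{T′})`, `(u b a)^M = 1`, such that at every geometric point `t : Spec Ω → T′` with `M ≠ 0` in `Ω`, for every
ample witness `Θ` of the polarisation on the fibre `A_{t ≫ f}` (★ `IsLambdaOfAt`) and all `M`-torsion sections `a, b` of `A_{T′}`:
`ē^Θ_M(a(t), b(t)) = (u b a)(t)⁻¹` (★ `baseChangeTorsionPt` for the fibre values).  The function `u b a` does not depend on `t` or `Θ`.  (★ W1b
`TorsionPairing.exists_poincarePairingUnit_fun` over the carrier's `hatNormalised`, ★ W3-core `weilPairingLevel_baseChangeTorsionPt_eq_inv`.)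
[cite: MumfordAV1970, §20 (p. 184) and §23 (p. 228)] [cite: Milne1986AbelianVarieties, §16 (p. 132)] -/
theorem exists_pairingUnit_weilPairingLevel_eq_inv {S : Scheme.{u}} [IsReduced S] [IsLocallyNoetherian S]
    (P : PolarizedAbelianSchemeWithLevel g N δ S) {T' : Scheme.{u}} [IsLocallyNoetherian T'] (f : T' ⟶ S)
    [IsCommMonObj (P.A.baseChange f).X] (M : ℕ) [NeZero M] :
    ∃ u : (P.A.baseChange f).torsionSections M → (P.A.baseChange f).torsionSections M → Γ(T', ⊤),
      (∀ a b, u b a ^ M = 1) ∧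
      ∀ {Ω : Type u} [Field Ω] (t : Spec (.of Ω) ⟶ T') (hM : (M : Ω) ≠ 0)
        (Θ : CartierDivisor (P.A.fibre (t ≫ f)).toAbelianVariety.X.left), P.A.IsLambdaOfAt (t ≫ f) P.D P.pol.lam Θ →
        ∀ a b : (P.A.baseChange f).torsionSections M,
        haveI := AbelianVariety.isDominant_toSchemeHom_zsmul_of_ne_zero (P.A.fibre (t ≫ f)).toAbelianVariety hM
        (P.A.fibre (t ≫ f)).toAbelianVariety.weilPairingLevel Θ (P.A.baseChangeTorsionPt M f t a)
            (P.A.baseChangeTorsionPt M f t b) =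
          ((Scheme.ΓSpecIso (.of Ω)).hom (t.appTop (u b a)))⁻¹ := by
  classical
  haveI : IsMonHom P.pol.lam := P.pol.isMonHom
  -- the pairing units of `A_{T′}[M](T′)` acting on `L_{c_b}` over `[M]_{A_{T′}}`, for every `b` (★ W1b)
  have hex := fun b : (P.A.baseChange f).torsionSections M =>
    AbelianSchemeOver.TorsionPairing.exists_poincarePairingUnit_fun P.D f P.hatNormalised (P.A.torsionPointHat M f P.D P.pol.lam b)
      (P.A.torsionPointHat_pow_eq_one M f P.D P.pol.lam b) ((P.A.baseChange f).translationActionMulN M)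
  choose e u hu using hex
  refine ⟨u, fun a b => ?_, fun t hM Θ hΘ a b => ?_⟩
  · exact AbelianSchemeOver.TorsionPairing.pairingUnit_pow_eq_one (P.A.baseChange f) ((P.A.baseChange f).translationActionMulN M) _
      (e b) (u b) (hu b) (Subtype.ext ((P.A.baseChange f).torsionSections_pow M a))
  · exact P.A.weilPairingLevel_baseChangeTorsionPt_eq_inv M P.D P.pol.lam f t hM Θ hΘ b (e b) (u b) (hu b) a

end Literature.AlgebraicGeometry.AbelianSchemes.PolarizedAbelianSchemeWithLevel

end
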